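import Literature.Geometry.Kaehler.ComplexTorusFourierWeylOperator
import HarnessLib

/-!
# Polishchuk's relations for the transported Fourier transform `F_d = χ(d)⁻¹ φ^* ∘ F` on `H•(X)`:
# `F_d ∘ L = −Λ ∘ F_d`, `F_d ∘ Λ = −L ∘ F_d`, `F_d² = (−1)^g [−1]^*` (Polishchuk 2007, §1: "`F_d e F_d⁻¹ = −f`, `F_d f F_d⁻¹ = −e`", "`F_d² = (−1)^g[−1]^*`")

Layer `Literature/Geometry/Kaehler`, namespace `Literature.Geometry.Kaehler.ComplexTorus`; lane `lit-hodgefound` (Track 2 foundations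
library), prover seat `lit-hodgefound-p09` (generation 51, row g51-#6). THEOREMS ONLY (no definition, no named fact, no instance, no
notation; D-0026 net debt `0`). Sequel of row g51-#4 `ComplexTorusFourierWeylOperator`: there `φ^* ∘ F = (−1)^g χ(d) · w` with
`w = exp(Λ_η) exp(−L_η) exp(Λ_η)` the Weyl operator of the Lefschetz `𝔰𝔩₂` `(L_η, Λ_η, H)` on `H•(X; ℂ) = GForm E ℂ`; since
`w L = −Λ w`, `w Λ = −L w` (`weylOperator_mul_e`, `weylOperator_mul_dual`, André) and `w² = (−1)^{k−g}` on `Hᵏ`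
(`weylOperator_weylOperator_apply_of_mem`), the transported Fourier transform `T = φ^* ∘ F` obeys the same relations ON `X` — for every
polarisation type and every lattice basis (the tree's row g50-#4 `ComplexTorusFourierLefschetzIntertwining` has the `X̂`-side
intertwining with the DUAL polarisation `E_δ`; here everything is pulled back to `X` along `φ`).

SETTING. `X = E/Φ(ℤ^ι)`, `η` a Riemann form of type `(d₁, …, d_g)`, `χ(d) = d₁⋯d_g`, `φ : V →L[ℝ] Ω̄` real-linear with `Im φ(u)(w) = η(u, w)`
(e.g. `φ_H`), `F = fourierForm Φ e h` ((6.11), degree bookkeeping `k + m = N = 2g`), `L = lefschetzPow η 1` (`x ↦ η ∧ x`),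
`Λ = lefschetzDual η` (Voisin's Lemma 6.19), `T(x) = φ^*F(x) = (F x).compContinuousLinearMap φ`.

## What is proved

* §1 **`IsPolarizationType.fourierForm_lefschetzPow_one_compContinuousLinearMap`: `T(η ∧ x) = −Λ(T x)`** for `x ∈ Hᵏ(X; ℂ)`
  ("`F_d e F_d⁻¹ = −f`") and **`IsPolarizationType.fourierForm_lefschetzDual_compContinuousLinearMap`: `T(Λ x) = −η ∧ T(x)`**
  ("`F_d f F_d⁻¹ = −e`"); `H`'s relation `F_d h F_d⁻¹ = −h` is the degree bookkeeping `T : Hᵏ → H^{2g−k}` itself.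
* §2 **`IsPolarizationType.fourierForm_compContinuousLinearMap_fourierForm_compContinuousLinearMap`:
  `T(T x) = (−1)^{g+k} χ(d)² · x` for `x ∈ Hᵏ(X; ℂ)`** — i.e. `F_d² = (−1)^g (−1)^k = (−1)^g[−1]^*` on `Hᵏ` ("`F_d² = (−1)^g[−1]^*`",
  after Künnemann [K] Lemma 6.1) — from `w² = (−1)^{k−g}` on `Hᵏ`; `IsPrincipalPolarization.…` the principal case with `φ = φ_H`:
  `φ_H^*F(φ_H^*F(x)) = (−1)^{g+k} x`.

## Sources, VERBATIM

* A. Polishchuk, *Fourier-stable subrings in the Chow rings of abelian varieties* (2007) [Polishchuk2007FourierStable], §1 p. 3 (held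
  text `paper:arxiv-0705.0772`, p0003 L69–L110): "`e(x) = d·x`, `f(x) = (d^{g−1}/((g−1)! χ(d))) ∗ x`, `h|_{CH^p_s(A)} = (2p−s−g) id`";
  "`F_d = (1/χ(d)) φ^* ∘ F`"; "Then one has `F_d² = (−1)^g[−1]^*` (see [K], Lemma 6.1)."; "`F_d e F_d⁻¹ = −f`, `F_d f F_d⁻¹ = −e`,
  `F_d h F_d⁻¹ = −h`."; "**Lemma 1.4.** … `(−1)^g F_d = exp(e) exp(−f) exp(e)`".
* Y. André, *Pour une théorie inconditionnelle des motifs* (1996) [Andre1996Motifs], §1.2 (p. 11): `w L w⁻¹ = −ᶜΛ`, `w ᶜΛ w⁻¹ = −L`,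
  `w²` = the central element.
* H. Lange, *Abelian Varieties over the Complex Numbers* (2023) [Lange2023AbelianVarietiesComplex], §6.2.4 (6.11), Prop. 6.2.20 (p. 310),
  Cor. 6.2.19 (`F̂ ∘ F = (−1)^g (−1)_X^*`); C. Voisin, *Hodge Theory I* [Voisin2002], §6.2.1 Lemma 6.19 (`Λ`).

## Scope

The relations are stated degree-wise for the tree's `fourierForm`, `lefschetzPow η 1`, `lefschetzDual η`; the tree's `e, f` are
`(L_η, Λ_η)` (not Polishchuk's Chow-theoretic `e = d·`, `f = (d^{g−1}/((g−1)!χ)) ∗`; no dictionary between the two normalisations is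
asserted beyond the proved identities).
-/

noncomputable section

-- `Module ℂ` / `SMulZeroClass ℂ` synthesis on `E [⋀^Fin k]→L[ℝ] ℂ` (as in `ComplexTorusLefschetzDecomposition`)
set_option maxSynthPendingDepth 3

namespace Literature.Geometry.Kaehler

namespace ComplexTorus

open Module Function Finset
open Literature.LinearAlgebra.Alternating Literature.Algebra.Lie

universe uE

variable {ι : Type*} [Fintype ι] [DecidableEq ι] {E : Type uE} [NormedAddCommGroup E] [NormedSpace ℂ E]
  [FiniteDimensional ℂ E] [Nontrivial E] (Φ : (ι → ℝ) ≃L[ℝ] E) {η : E [⋀^Fin 2]→L[ℝ] ℝ} {N : ℕ}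

omit [Fintype ι] [DecidableEq ι] [FiniteDimensional ℂ E] [Nontrivial E] in
/-- The target degree of `Lʳ` is transported along `GForm.of`. [folklore] -/
private theorem of_lefschetzPow_congr₅₄ (η : E [⋀^Fin 2]→L[ℝ] ℝ) (r : ℕ) {k n n' : ℕ} (h : 2 * r + k = n) (h' : 2 * r + k = n')
    (x : E [⋀^Fin k]→L[ℝ] ℂ) : GForm.of n (lefschetzPow η r h x) = GForm.of n' (lefschetzPow η r h' x) := by
  subst h; subst h'; rfl

omit [Fintype ι] [DecidableEq ι] [FiniteDimensional ℂ E] [Nontrivial E] in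
/-- `of k₂ (L x) = L_G (of k x)` for any presentation `2·1 + k = k₂` of the target degree. [cite: Huybrechts2005, §1.2 Prop. 1.2.26] -/
private theorem of_lefschetzPow_one_eq_lefschetzG₅₄ (η : E [⋀^Fin 2]→L[ℝ] ℝ) {k k₂ : ℕ} (hk : 2 * 1 + k = k₂) (x : E [⋀^Fin k]→L[ℝ] ℂ) :
    GForm.of k₂ (lefschetzPow η 1 hk x) = lefschetzG η (GForm.of k x) := by
  rw [lefschetzG_of, of_lefschetzPow_congr₅₄ η 1 hk (show 2 * 1 + k = k + 2 by omega) x]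

omit [Fintype ι] [DecidableEq ι] [FiniteDimensional ℂ E] [Nontrivial E] in
/-- `(−1)^g (−1)^g = 1`. [folklore] -/
private theorem neg_one_pow_mul_neg_one_pow₅₄ (g : ℕ) : (-1 : ℂ) ^ g * (-1) ^ g = 1 := by
  rw [← pow_add, ← two_mul, pow_mul, neg_one_sq, one_pow]

omit [Fintype ι] [DecidableEq ι] [FiniteDimensional ℂ E] [Nontrivial E] in
/-- `(−1)^{|k−g|} = (−1)^{g+k}`. [folklore] -/
private theorem neg_one_pow_natAbs_sub₅₄ (k g : ℕ) : (-1 : ℂ) ^ ((k : ℤ) - (g : ℤ)).natAbs = (-1) ^ (g + k) := by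
  obtain h | h := le_total g k
  · rw [show ((k : ℤ) - g).natAbs = k - g by omega, show g + k = (k - g) + 2 * g by omega, pow_add, pow_mul, neg_one_sq,
      one_pow, mul_one]
  · rw [show ((k : ℤ) - g).natAbs = g - k by omega, show g + k = (g - k) + 2 * k by omega, pow_add, pow_mul, neg_one_sq,
      one_pow, mul_one]

/-! ## §1 `T(η ∧ x) = −Λ(T x)` and `T(Λ x) = −η ∧ T(x)` -/

section Intertwining

/-- **`φ^*F(η ∧ x) = −Λ_η(φ^*F(x))` ("`F_d e F_d⁻¹ = −f`")**: for a polarisation `η` of type `d`, every real-linear `φ` with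
`Im φ(u)(w) = η(u, w)`, every lattice frame `e` and every `x ∈ Hᵏ(X; ℂ)` — the transported Fourier transform carries the Lefschetz
operator `L_η = η ∧ ·` of `X` to MINUS the dual Lefschetz operator `Λ_η` of `X` (degrees: `x ∈ Hᵏ`, `η ∧ x ∈ H^{k₂}`, `k₂ = k + 2`,
`φ^*F(x) ∈ H^{m+2}`, `φ^*F(η ∧ x) ∈ Hᵐ`, `k + (m+2) = k₂ + m = 2g`). From `φ^*∘F = (−1)^g χ(d)·w` (row g51-#4) and `w L = −Λ w` (André).
[cite: Polishchuk2007FourierStable, §1 (p. 3, "F_d e F_d⁻¹ = −f") and Lemma 1.4] [cite: Andre1996Motifs, §1.2 (p. 11)]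
[cite: Lange2023AbelianVarietiesComplex, §6.2.4 (6.11) p. 311] -/
theorem IsPolarizationType.fourierForm_lefschetzPow_one_compContinuousLinearMap (hR : IsRiemannForm Φ η) {g : ℕ} {d : Fin g → ℕ}
    (hd : IsPolarizationType Φ η d) (φ : E →L[ℝ] (E →L⋆[ℂ] ℂ)) (hφ : ∀ u w, (φ u w).im = η ![u, w]) (e : Fin N ≃ ι)
    {k k₂ m : ℕ} (hk : 2 * 1 + k = k₂) (h : k + (m + 2) = N) (h' : k₂ + m = N) (x : E [⋀^Fin k]→L[ℝ] ℂ) :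
    (fourierForm Φ e h' (lefschetzPow η 1 hk x)).compContinuousLinearMap φ =
      -lefschetzDual η m ((fourierForm Φ e h x).compContinuousLinearMap φ) := by
  have hη : ∀ v : E, v ≠ 0 → ∃ w : E, η ![v, w] ≠ 0 := fun v hv ↦ not_forall.1 fun hc ↦ hv (hR.nondegenerate v hc)
  apply GForm.of_injective m
  rw [GForm.of_neg, hd.of_fourierForm_compContinuousLinearMap Φ hR hη φ hφ e h' (lefschetzPow η 1 hk x),
    of_lefschetzPow_one_eq_lefschetzG₅₄, ← Module.End.mul_apply, (hasLefschetzProperty_lefschetzG hη).weylOperator_mul_e isZGrading_countingG,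
    LinearMap.neg_apply, Module.End.mul_apply, smul_neg, ← map_smul, ← hd.of_fourierForm_compContinuousLinearMap Φ hR hη φ hφ e h x,
    dual_lefschetzG_eq_lefschetzDualG hη, lefschetzDualG_of_add_two]

/-- **`φ^*F(Λ_η x) = −η ∧ φ^*F(x)` ("`F_d f F_d⁻¹ = −e`")**: the transported Fourier transform carries the dual Lefschetz operator `Λ_η`
of `X` to MINUS the Lefschetz operator `L_η` (degrees: `x ∈ H^{k+2}`, `Λx ∈ Hᵏ`, `φ^*F(x) ∈ Hᵐ`, `φ^*F(Λx) ∈ H^{m₂}`, `m₂ = m + 2`,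
`(k+2) + m = k + m₂ = 2g`). From `φ^*∘F = (−1)^g χ(d)·w` and `w Λ = −L w` (André).
[cite: Polishchuk2007FourierStable, §1 (p. 3, "F_d f F_d⁻¹ = −e") and Lemma 1.4] [cite: Andre1996Motifs, §1.2 (p. 11)]
[cite: Lange2023AbelianVarietiesComplex, §6.2.4 (6.11) p. 311] [cite: Voisin2002, §6.2.1 Lemma 6.19] -/
theorem IsPolarizationType.fourierForm_lefschetzDual_compContinuousLinearMap (hR : IsRiemannForm Φ η) {g : ℕ} {d : Fin g → ℕ}
    (hd : IsPolarizationType Φ η d) (φ : E →L[ℝ] (E →L⋆[ℂ] ℂ)) (hφ : ∀ u w, (φ u w).im = η ![u, w]) (e : Fin N ≃ ι)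
    {k m m₂ : ℕ} (hm : 2 * 1 + m = m₂) (h : k + 2 + m = N) (h' : k + m₂ = N) (x : E [⋀^Fin (k + 2)]→L[ℝ] ℂ) :
    (fourierForm Φ e h' (lefschetzDual η k x)).compContinuousLinearMap φ =
      -lefschetzPow η 1 hm ((fourierForm Φ e h x).compContinuousLinearMap φ) := by
  have hη : ∀ v : E, v ≠ 0 → ∃ w : E, η ![v, w] ≠ 0 := fun v hv ↦ not_forall.1 fun hc ↦ hv (hR.nondegenerate v hc)
  apply GForm.of_injective m₂
  rw [GForm.of_neg, hd.of_fourierForm_compContinuousLinearMap Φ hR hη φ hφ e h' (lefschetzDual η k x), ← lefschetzDualG_of_add_two,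
    ← dual_lefschetzG_eq_lefschetzDualG hη, ← Module.End.mul_apply,
    (hasLefschetzProperty_lefschetzG hη).weylOperator_mul_dual isZGrading_countingG, LinearMap.neg_apply, Module.End.mul_apply, smul_neg,
    ← map_smul, ← hd.of_fourierForm_compContinuousLinearMap Φ hR hη φ hφ e h x, of_lefschetzPow_one_eq_lefschetzG₅₄]

end Intertwining

/-! ## §2 `T(T x) = (−1)^{g+k} χ(d)² · x`: "`F_d² = (−1)^g [−1]^*`" -/

section Square

/-- **`φ^*F(φ^*F(x)) = (−1)^{g+k} χ(d)² · x` for `x ∈ Hᵏ(X; ℂ)`** (`k + m = m + k = 2g`): the transported Fourier transform squares to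
`χ(d)²` (`= deg φ_L`) times the sign `(−1)^{g+k}` — in Polishchuk's normalisation `F_d = χ(d)⁻¹ φ^*∘F` this is "`F_d² = (−1)^g[−1]^*`"
(`[−1]^* = (−1)^k` on `Hᵏ`). From `φ^*∘F = (−1)^g χ(d)·w` and `w² = (−1)^{k−g}` on `Hᵏ` (the central element of `SL₂`).
[cite: Polishchuk2007FourierStable, §1 (p. 3, "F_d² = (−1)^g[−1]^*") and Lemma 1.4] [cite: Andre1996Motifs, §1.2 (p. 11)]
[cite: Lange2023AbelianVarietiesComplex, §6.2.4 Cor. 6.2.19 and Prop. 6.2.20 p. 310] -/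
theorem IsPolarizationType.fourierForm_compContinuousLinearMap_fourierForm_compContinuousLinearMap (hR : IsRiemannForm Φ η) {g : ℕ}
    {d : Fin g → ℕ} (hd : IsPolarizationType Φ η d) (φ : E →L[ℝ] (E →L⋆[ℂ] ℂ)) (hφ : ∀ u w, (φ u w).im = η ![u, w])
    (e : Fin N ≃ ι) {k m : ℕ} (h : k + m = N) (h' : m + k = N) (x : E [⋀^Fin k]→L[ℝ] ℂ) :
    (fourierForm Φ e h' ((fourierForm Φ e h x).compContinuousLinearMap φ)).compContinuousLinearMap φ =
      ((-1 : ℂ) ^ (g + k) * (∏ i, (d i : ℂ)) ^ 2) • x := by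
  have hη : ∀ v : E, v ≠ 0 → ∃ w : E, η ![v, w] ≠ 0 := fun v hv ↦ not_forall.1 fun hc ↦ hv (hR.nondegenerate v hc)
  have hcard : Fintype.card ι = N := by simpa using (Fintype.card_congr e).symm
  have hg : g = finrank ℂ E := by have := hd.card_eq; have := finrank_complex_mul_two Φ e; omega
  subst hg
  apply GForm.of_injective k
  rw [hd.of_fourierForm_compContinuousLinearMap Φ hR hη φ hφ e h' _, hd.of_fourierForm_compContinuousLinearMap Φ hR hη φ hφ e h x,
    map_smul, (hasLefschetzProperty_lefschetzG hη).weylOperator_weylOperator_apply_of_mem isZGrading_countingG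
      (of_mem_degreeSpace_countingG (E := E) k x), smul_smul, smul_smul, GForm.of_smul, neg_one_pow_natAbs_sub₅₄]
  congr 1
  ring_nf
  rw [show (finrank ℂ E) * 3 = finrank ℂ E + 2 * finrank ℂ E by ring, pow_add, pow_mul, neg_one_sq, one_pow, mul_one]

/-- **`φ_H^*F(φ_H^*F(x)) = (−1)^{g+k} · x` on `Hᵏ(X; ℂ)` for a principally polarised `X`** (`χ = 1`, `φ = φ_H`, `g = dim_ℂ X`):
"`F_d² = (−1)^g[−1]^*`" with `F_d = φ_H^* ∘ F`. [cite: Polishchuk2007FourierStable, §1 (p. 3, "F_d² = (−1)^g[−1]^*")]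
[cite: Lange2023AbelianVarietiesComplex, §6.2.4 Cor. 6.2.19 and Prop. 6.2.20 p. 310] -/
theorem IsPrincipalPolarization.fourierForm_comp_phiHRep_fourierForm_comp_phiHRep (hp : IsPrincipalPolarization Φ η) (e : Fin N ≃ ι)
    {k m : ℕ} (h : k + m = N) (h' : m + k = N) (x : E [⋀^Fin k]→L[ℝ] ℂ) :
    (fourierForm Φ e h' ((fourierForm Φ e h x).compContinuousLinearMap ((phiHRep Φ hp.isRiemannForm.1).restrictScalars ℝ))).compContinuousLinearMap
        ((phiHRep Φ hp.isRiemannForm.1).restrictScalars ℝ) = ((-1 : ℂ) ^ (finrank ℂ E + k)) • x := by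
  obtain ⟨g, d, hd, h1⟩ := hp.exists_type_eq_one
  have hcard : Fintype.card ι = N := by simpa using (Fintype.card_congr e).symm
  have hg : g = finrank ℂ E := by have := hd.card_eq; have := finrank_complex_mul_two Φ e; omega
  subst hg
  rw [hd.fourierForm_compContinuousLinearMap_fourierForm_compContinuousLinearMap Φ hp.isRiemannForm _ (fun u w ↦ im_phiHFun η u w) e h h' x]
  simp [h1]

end Square

end ComplexTorus

end Literature.Geometry.Kaehler

end
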